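import Mathlib
import HarnessLib
import Summits.ValiantsHypothesis.ValiantsHypothesis.Theorems.MonotoneRestorationOrbitRestorationQPSmlAffineRowRestoration
import Summits.ValiantsHypothesis.ValiantsHypothesis.Theorems.MonotoneRestorationOrbitRestorationQPWildResidueSharp

/-!
# The affine set-multilinear strata PER LEVEL (uniform constants) and the sharpened wild residue of A_∞
(crux `OrbitRestorationQP`, stmt-ValiantsHypothesis-18293 — lane SML of stub A_∞ `stub_sigmaPiSigmaValue`)

`…SmlAffineRestoration.lean` / `…SmlAffineRowRestoration.lean` are FAMILY-level statements (`∀ f, … → ∃ c', ∀ n, …`).  For the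
residue bookkeeping of the rung (`…Residue.lean`, `…WildResidueSharp.lean`: "A_∞ follows from restoring the polynomials outside
the landed strata, with one constant per exponent") the strata are needed PER LEVEL with a constant depending on the exponent
`c` only.  The constants of the lane are in fact uniform (`zeta_poly_mul_qp_le`, `exists_pow_add_lt_choose`, brute force below
the threshold), so we re-assemble the chain levelwise:

* `circuitOfEquivariantTerms_level` — stub B per level: `∀ c ∃ c' ∀ n T, IsEquivariantTerms n c T → QPOrbitRestorable c' n (Σ Π T)`;
* `affineColSml_restorable_uniform` — **`∀ c ∃ c' ∀ n p`: a matrix-symmetric `p` at level `n` with an affine column-sml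
  expression of at most `n^c + c` product gates is `QPOrbitRestorable c' n p`;**
* `affineRowSml_restorable_uniform` — the row twin (transpose, `+3`);
* `sigmaPiSigmaValue_of_sharpResidue₅` — **SHARPER RESIDUE, FIVE EXCLUSIONS ⇒ A_∞**: the registered stub follows from
  restoring, with one constant per exponent `c`, the matrix-symmetric `p ∈ PDClass (fun _ => 1) n c` that have no groupable
  representation, are not killed by some double-difference derivation, are not invariant under the within-row permutations of
  some row nor under the within-column permutations of some column, AND have NO affine column-sml and NO affine row-sml
  expression with at most `n^c + c` product gates.

Honest label: bookkeeping over landed theorems (the census in kernel form); no stub closed; VP ≠ VNP untouched. [folklore]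
-/

noncomputable section

open scoped Classical

-- `Summit.ValiantsHypothesis.ValiantsHypothesis.…` is the tree's single-conjunct layout (Sub = Summit).
set_option linter.dupNamespace false

namespace Summit.ValiantsHypothesis.ValiantsHypothesis.Theorems.SmlAffineRestoration

open MvPolynomial Finset Equiv Literature.Computability.AlgebraicComplexity OrbitRestorationQPDepthThreeRung SmlNumeric
  SmlEquivariantForm SmlRestoration SmlAffineNarrow

/-! ### Stub B per level -/

/-- **Stub B per level, uniform constant.** [folklore] -/
theorem circuitOfEquivariantTerms_level (c : ℕ) : ∃ c' : ℕ, ∀ (n : ℕ)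
    (T : Multiset (Multiset (MvPolynomial (Fin n × Fin n) ℂ))), IsEquivariantTerms n c T →
      QPOrbitRestorable c' n ((T.map Multiset.prod).sum) := by
  obtain ⟨c₃, hc₃⟩ := zeta_poly_mul_qp_le 25 2 c 4
  refine ⟨c₃, fun n T hT => ?_⟩
  have hone : ∀ m : ℕ, 1 ≤ 2 ^ ((Nat.log 2 m + c₃) ^ c₃) := fun _ => Nat.one_le_two_pow
  unfold QPOrbitRestorable
  rcases Nat.eq_zero_or_pos n with rfl | hn
  · obtain ⟨G, inst, C, hC, hev, hcard⟩ := zeta_symmetric_constant (X := Fin 0 × Fin 0)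
      (Γ := Equiv.Perm (Fin 0)) (MvPolynomial.coeff 0 ((T.map Multiset.prod).sum))
    refine ⟨G, inst, C, hC, ?_, ((C.orbitSize_le_size _).trans hcard).trans (hone 0)⟩
    rw [hev]
    exact (MvPolynomial.eq_C_of_isEmpty _).symm
  · haveI : NeZero n := ⟨by omega⟩
    by_cases hT0 : T = 0
    · obtain ⟨G, inst, C, hC, hev, hcard⟩ := zeta_symmetric_constant (X := Fin n × Fin n)
        (Γ := Equiv.Perm (Fin n)) (0 : ℂ)
      refine ⟨G, inst, C, hC, ?_, ((C.orbitSize_le_size _).trans hcard).trans (hone n)⟩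
      rw [hev, hT0, Multiset.map_zero, Multiset.sum_zero, map_zero]
    · obtain ⟨h1, h2, h3, h4⟩ := hT
      obtain ⟨G, inst, C, hC, hev, hcard⟩ :=
        eqvTerms_symmetric_size (2 ^ ((Nat.log 2 n + c) ^ c)) T hT0 h1 h2 h3 h4
      refine ⟨G, inst, C, hC, hev, (C.orbitSize_le_size _).trans (hcard.trans ?_)⟩
      refine (eqvTerms_size_arith n _ Nat.one_le_two_pow).trans ?_
      rw [← pow_mul, mul_comm ((Nat.log 2 n + c) ^ c) 4]
      exact hc₃ n

/-! ### The affine equivariant term multiset at one level -/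

/-- **The affine equivariant term multiset of level `n` is equivariant** (constant `2(w+1)+2`), for any coefficient table `d`.
[folklore] -/
theorem isEquivariantTerms_affineNormalForm {n w : ℕ} (d : Fin (n + 1) × (Fin w → Fin (n + 1)) → ℂ) :
    IsEquivariantTerms n (2 * (w + 1) + 2)
      ((Finset.univ : Finset ((Fin (n + 1) × (Fin w → Fin (n + 1))) × (Fin w → Fin n))).val.map fun βτg =>
        C (d βτg.1) ::ₘ (Finset.univ : Finset (Fin n)).val.map fun b =>
          C ((βτg.1.1 : ℕ) : ℂ) +
            ∑ a : Fin n, C (1 + ∑ i : Fin w, if βτg.2 i = a then ((βτg.1.2 i : ℕ) : ℂ) else 0) * X (a, b)) := by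
  have hbound : (n + 1) ^ (2 * (w + 1)) ≤ 2 ^ ((Nat.log 2 n + (2 * (w + 1) + 2)) ^ (2 * (w + 1) + 2)) :=
    succ_pow_le_qp (w + 1) n
  refine ⟨?_, ?_, ?_, ?_⟩
  · intro m hm ℓ hℓ
    obtain ⟨βτg, _, rfl⟩ := Multiset.mem_map.1 hm
    rcases Multiset.mem_cons.1 hℓ with rfl | hℓ
    · rw [totalDegree_C]; exact Nat.zero_le _
    · obtain ⟨b, _, rfl⟩ := Multiset.mem_map.1 hℓ
      exact totalDegree_affineGenFactor_le _ _ _ _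
  · rw [Multiset.card_map, Finset.card_val, Finset.card_univ, Fintype.card_prod, Fintype.card_prod, Fintype.card_fun,
      Fintype.card_fun, Fintype.card_fin, Fintype.card_fin, Fintype.card_fin]
    refine le_trans ?_ hbound
    calc (n + 1) * (n + 1) ^ w * n ^ w ≤ (n + 1) * (n + 1) ^ w * (n + 1) ^ w :=
          Nat.mul_le_mul_left _ (Nat.pow_le_pow_left (by omega) _)
      _ = (n + 1) ^ (2 * w + 1) := by rw [← pow_succ', ← pow_add]; ring_nf
      _ ≤ (n + 1) ^ (2 * (w + 1)) := Nat.pow_le_pow_right (by omega) (by omega)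
  · intro m hm
    obtain ⟨βτg, _, rfl⟩ := Multiset.mem_map.1 hm
    rw [Multiset.card_cons, Multiset.card_map, Finset.card_val, Finset.card_univ, Fintype.card_fin]
    refine le_trans ?_ hbound
    calc n + 1 = (n + 1) ^ 1 := (pow_one _).symm
      _ ≤ (n + 1) ^ (2 * (w + 1)) := Nat.pow_le_pow_right (by omega) (by omega)
  · intro σ
    rw [Multiset.map_map]
    have hterm : ∀ βτg : (Fin (n + 1) × (Fin w → Fin (n + 1))) × (Fin w → Fin n),
        ((Multiset.map fun ℓ => rename (fun pq : Fin n × Fin n => σ • pq) ℓ) ∘ fun βτg =>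
          C (d βτg.1) ::ₘ (Finset.univ : Finset (Fin n)).val.map fun b =>
            C ((βτg.1.1 : ℕ) : ℂ) +
              ∑ a : Fin n, C (1 + ∑ i : Fin w, if βτg.2 i = a then ((βτg.1.2 i : ℕ) : ℂ) else 0) * X (a, b)) βτg =
        C (d βτg.1) ::ₘ (Finset.univ : Finset (Fin n)).val.map fun b =>
          C ((βτg.1.1 : ℕ) : ℂ) +
            ∑ a : Fin n, C (1 + ∑ i : Fin w, if σ (βτg.2 i) = a then ((βτg.1.2 i : ℕ) : ℂ) else 0) * X (a, b) := by
      intro βτg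
      simp only [Function.comp_apply, Multiset.map_cons, rename_C, Multiset.map_map]
      congr 1
      rw [Multiset.map_congr rfl (fun b _ => rename_diag_affineGenFactor σ βτg.1.1 βτg.1.2 βτg.2 b)]
      exact map_univ_comp_equiv σ (fun b => C ((βτg.1.1 : ℕ) : ℂ) + ∑ a : Fin n,
        C (1 + ∑ i : Fin w, if σ (βτg.2 i) = a then ((βτg.1.2 i : ℕ) : ℂ) else 0) * X (a, b))
    rw [Multiset.map_congr rfl (fun βτg _ => hterm βτg)]
    exact map_univ_comp_equiv
      (Equiv.prodCongr (Equiv.refl (Fin (n + 1) × (Fin w → Fin (n + 1)))) (Equiv.arrowCongr (Equiv.refl (Fin w)) σ))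
      (fun βτg : (Fin (n + 1) × (Fin w → Fin (n + 1))) × (Fin w → Fin n) =>
        C (d βτg.1) ::ₘ (Finset.univ : Finset (Fin n)).val.map fun b =>
          C ((βτg.1.1 : ℕ) : ℂ) +
            ∑ a : Fin n, C (1 + ∑ i : Fin w, if βτg.2 i = a then ((βτg.1.2 i : ℕ) : ℂ) else 0) * X (a, b))

/-- The value of the affine equivariant term multiset. [folklore] -/
theorem sum_prod_affineNormalForm {n w : ℕ} (d : Fin (n + 1) × (Fin w → Fin (n + 1)) → ℂ) :
    ((((Finset.univ : Finset ((Fin (n + 1) × (Fin w → Fin (n + 1))) × (Fin w → Fin n))).val.map fun βτg =>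
        C (d βτg.1) ::ₘ (Finset.univ : Finset (Fin n)).val.map fun b =>
          C ((βτg.1.1 : ℕ) : ℂ) +
            ∑ a : Fin n, C (1 + ∑ i : Fin w, if βτg.2 i = a then ((βτg.1.2 i : ℕ) : ℂ) else 0) * X (a, b)).map
        Multiset.prod).sum) =
      ∑ βτg : (Fin (n + 1) × (Fin w → Fin (n + 1))) × (Fin w → Fin n), C (d βτg.1) *
        ∏ b : Fin n, (C ((βτg.1.1 : ℕ) : ℂ) +
          ∑ a : Fin n, C (1 + ∑ i : Fin w, if βτg.2 i = a then ((βτg.1.2 i : ℕ) : ℂ) else 0) * X (a, b)) := by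
  rw [Multiset.map_map, Finset.sum_eq_multiset_sum]
  refine congrArg _ (Multiset.map_congr rfl fun βτg _ => ?_)
  simp only [Function.comp_apply, Multiset.prod_cons, Finset.prod_eq_multiset_prod]

/-! ### The strata per level, uniform constants -/

/-- **THE AFFINE COLUMN-SML STRATUM PER LEVEL** (one constant per exponent `c`). [folklore] -/
theorem affineColSml_restorable_uniform (c : ℕ) : ∃ c' : ℕ, ∀ (n : ℕ) (p : MvPolynomial (Fin n × Fin n) ℂ),
    (∀ σ τ : Perm (Fin n), rename (fun q : Fin n × Fin n => (σ q.1, τ q.2)) p = p) →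
    (∃ (s : ℕ) (β : Fin s → Fin n → ℂ) (α : Fin s → Fin n → Fin n → ℂ), s ≤ n ^ c + c ∧
      p = ∑ t : Fin s, ∏ b : Fin n, (C (β t b) + ∑ a : Fin n, C (α t b a) * X (a, b))) →
    QPOrbitRestorable c' n p := by
  obtain ⟨N₀, hN₀⟩ := exists_pow_add_lt_choose c
  obtain ⟨c₃, hc₃⟩ := circuitOfEquivariantTerms_level (2 * (c + 1 + 1) + 2)
  refine ⟨max c₃ ((max N₀ (2 * c + 4)).factorial + 5), fun n p hsym ⟨s, β, α, hs, hp⟩ => ?_⟩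
  by_cases hn : max N₀ (2 * c + 4) ≤ n
  · have hrow : ∀ σ : Equiv.Perm (Fin n), rename (fun v : Fin n × Fin n => (σ v.1, v.2))
        (∑ t : Fin s, ∏ b : Fin n, (C (β t b) + ∑ a : Fin n, C (α t b a) * X (a, b)) :
          MvPolynomial (Fin n × Fin n) ℂ) =
        ∑ t : Fin s, ∏ b : Fin n, (C (β t b) + ∑ a : Fin n, C (α t b a) * X (a, b)) := by
      intro σ; rw [← hp]; simpa using hsym σ 1
    have hcol : ∀ τ : Equiv.Perm (Fin n), rename (fun v : Fin n × Fin n => (v.1, τ v.2))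
        (∑ t : Fin s, ∏ b : Fin n, (C (β t b) + ∑ a : Fin n, C (α t b a) * X (a, b)) :
          MvPolynomial (Fin n × Fin n) ℂ) =
        ∑ t : Fin s, ∏ b : Fin n, (C (β t b) + ∑ a : Fin n, C (α t b a) * X (a, b)) := by
      intro τ; rw [← hp]; simpa using hsym 1 τ
    have hlt : s < Nat.choose (n - (c + 1 + 1)) (c + 1 + 1) :=
      lt_of_le_of_lt hs (hN₀ n (le_trans (le_max_left _ _) hn))
    obtain ⟨d, hd⟩ := exists_equivariant_form_affine (w := c + 1) (by omega) β α hrow hcol hlt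
    have h := hc₃ n _ (isEquivariantTerms_affineNormalForm (w := c + 1) d)
    rw [sum_prod_affineNormalForm, ← hd, ← hp] at h
    exact Restorable.qpOrbitRestorable_mono (le_max_left _ _) h
  · have hinv : ∀ σ : Equiv.Perm (Fin n), ren σ p = p := fun σ => ValueOrbit.ren_eq_of_matrixSymmetric hsym σ
    refine Restorable.qpOrbitRestorable_mono ?_ (Restorable.qpOrbitRestorable_of_invariant p hinv)
    have : n.factorial ≤ (max N₀ (2 * c + 4)).factorial := Nat.factorial_le (by omega)
    omega

/-- **THE AFFINE ROW-SML STRATUM PER LEVEL** (transpose twin, `+3`). [folklore] -/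
theorem affineRowSml_restorable_uniform (c : ℕ) : ∃ c' : ℕ, ∀ (n : ℕ) (p : MvPolynomial (Fin n × Fin n) ℂ),
    (∀ σ τ : Perm (Fin n), rename (fun q : Fin n × Fin n => (σ q.1, τ q.2)) p = p) →
    (∃ (s : ℕ) (β : Fin s → Fin n → ℂ) (α : Fin s → Fin n → Fin n → ℂ), s ≤ n ^ c + c ∧
      p = ∑ t : Fin s, ∏ a : Fin n, (C (β t a) + ∑ b : Fin n, C (α t a b) * X (a, b))) →
    QPOrbitRestorable c' n p := by
  obtain ⟨c', hc'⟩ := affineColSml_restorable_uniform c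
  refine ⟨c' + 3, fun n p hsym ⟨s, β, α, hs, hp⟩ => ?_⟩
  refine Transpose.qpOrbitRestorable_of_transpose (hc' n _ (Transpose.matrixSymmetric_transpose hsym) ⟨s, β, α, hs, ?_⟩)
  rw [hp, rename_swap_affineRowSml]

/-! ### The sharpened residue -/

/-- **SHARPER RESIDUE, FIVE EXCLUSIONS ⇒ `A_∞`.**  The registered stub `stub_sigmaPiSigmaValue` (conclusion verbatim) follows from
restoring, with one constant per exponent, the matrix-symmetric members of `PDClass (fun _ => 1) n c` which are not groupable,
not in `ℂ[r,c]`, not row-wreath and not column-wreath symmetric, and have NO affine column-sml and NO affine row-sml expression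
with at most `n^c + c` product gates. [folklore] -/
theorem sigmaPiSigmaValue_of_sharpResidue₅
    (hW : ∀ c : ℕ, ∃ c' : ℕ, ∀ (n : ℕ) (p : MvPolynomial (Fin n × Fin n) ℂ),
      (∀ σ τ : Perm (Fin n), rename (fun q : Fin n × Fin n => (σ q.1, τ q.2)) p = p) →
      PDClass (fun _ => 1) n c p → ¬ GroupableUpTo 0 n c p →
      (∃ a a' b b' : Fin n, pderiv (a, b) p - pderiv (a', b) p - pderiv (a, b') p + pderiv (a', b') p ≠ 0) →
      (∃ (i : Fin n) (τ : Perm (Fin n)),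
        rename (fun q : Fin n × Fin n => if q.1 = i then (q.1, τ q.2) else q) p ≠ p) →
      (∃ (j : Fin n) (τ : Perm (Fin n)),
        rename (fun q : Fin n × Fin n => if q.2 = j then (τ q.1, q.2) else q) p ≠ p) →
      (¬ ∃ (s : ℕ) (β : Fin s → Fin n → ℂ) (α : Fin s → Fin n → Fin n → ℂ), s ≤ n ^ c + c ∧
        p = ∑ t : Fin s, ∏ b : Fin n, (C (β t b) + ∑ a : Fin n, C (α t b a) * X (a, b))) →
      (¬ ∃ (s : ℕ) (β : Fin s → Fin n → ℂ) (α : Fin s → Fin n → Fin n → ℂ), s ≤ n ^ c + c ∧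
        p = ∑ t : Fin s, ∏ a : Fin n, (C (β t a) + ∑ b : Fin n, C (α t a b) * X (a, b))) →
      QPOrbitRestorable c' n p) :
    ∀ f : (n : ℕ) → MvPolynomial (Fin n × Fin n) ℂ, IsMatrixSymmetric f →
      (∃ c : ℕ, ∀ n : ℕ, PDClass (fun _ => 1) n c (f n)) →
      ∃ c : ℕ, ∀ n : ℕ, QPOrbitRestorable c n (f n) := by
  refine WildResidueSharp.sigmaPiSigmaValue_of_sharpResidue₃ fun c => ?_
  obtain ⟨c', hc'⟩ := hW c
  obtain ⟨c₁, hc₁⟩ := affineColSml_restorable_uniform c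
  obtain ⟨c₂, hc₂⟩ := affineRowSml_restorable_uniform c
  refine ⟨max c' (max c₁ c₂), fun n p hsym hPD hng hD hrow hcol => ?_⟩
  by_cases hC : ∃ (s : ℕ) (β : Fin s → Fin n → ℂ) (α : Fin s → Fin n → Fin n → ℂ), s ≤ n ^ c + c ∧
      p = ∑ t : Fin s, ∏ b : Fin n, (C (β t b) + ∑ a : Fin n, C (α t b a) * X (a, b))
  · exact Restorable.qpOrbitRestorable_mono (le_max_of_le_right (le_max_left _ _)) (hc₁ n p hsym hC)
  by_cases hR : ∃ (s : ℕ) (β : Fin s → Fin n → ℂ) (α : Fin s → Fin n → Fin n → ℂ), s ≤ n ^ c + c ∧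
      p = ∑ t : Fin s, ∏ a : Fin n, (C (β t a) + ∑ b : Fin n, C (α t a b) * X (a, b))
  · exact Restorable.qpOrbitRestorable_mono (le_max_of_le_right (le_max_right _ _)) (hc₂ n p hsym hR)
  exact Restorable.qpOrbitRestorable_mono (le_max_left _ _) (hc' n p hsym hPD hng hD hrow hcol hC hR)

end Summit.ValiantsHypothesis.ValiantsHypothesis.Theorems.SmlAffineRestoration

end
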